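import Literature.Barriers.Parity.EquidistributionLimitsSieve
import Literature.Barriers.Parity.EquidistributionLimitsMatrix
import Literature.NumberTheory.LFunctions.MertensConstant
import Mathlib.NumberTheory.Bertrand
import Mathlib.NumberTheory.Primorial
import HarnessLib

/-!
# Discharge of `EquidistributionLimitBarrier` (Granville–Soundararajan 2007, Example 4)

`Literature.Barriers.Parity.EquidistributionLimitBarrier_holds` proves the catalogued barrier
`Literature.Barriers.Parity.EquidistributionLimitBarrier` of `EquidistributionLimits.lean`:
for every `u ≥ 1` there is `c = c(u) > 0` such that for every subset `𝒜` of the primes and every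
large `x` there are `ℓ ≤ x/(log x)^u`, `y ∈ (x/4, x)` and `(a, ℓ) = 1` with
`|𝒜(y; ℓ, a) - y𝒜(x)/(x φ(ℓ))| ≥ c 𝒜(x)/φ(ℓ)` [cite: GranvilleSoundararajan2007Uncertainty, Example 4].

## Proof

The source deduces Example 4 from its Corollary 1.3, i.e. from the Maier-matrix Proposition 2.2
(two arithmetic progressions played off against each other) and the oscillation theorem for mean
values of multiplicative functions (Theorem 3.1 / Corollary 3.2) applied to `f_q = 1_{(·,q)=1}`
[cite: GranvilleSoundararajan2007Uncertainty, §2 Proposition 2.2, deduction of Corollary 1.3, Example 2 and Example 4]. We follow the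
same architecture with one simplification available for subsets of the primes: the oscillation
theorem is replaced by an EXACT evaluation of the sifted proportion in a window (Brun's pure
sieve without error), `EquidistributionLimitsSieve.lean`.

Parameters for a given `u ≥ 1`: an integer `N > u`, `a = 4N+3`, `b = 4N+4`, `E = bN+N+1`
(`E/b = N + 1/4 > u`), `κ = log(b/a)`, `δ₁ = (κ/2)^{N+1}/(2(N+1)!)`, `c = δ₁/100`. For large `x`:
`t = ⌊(log x/2)^{1/b}⌋`, `q = ∏_{t^a < p ≤ t^b} p ≤ 4^{t^b} ≤ x^{log 2}` (Chebyshev bound for the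
primorial), `ℓ` a prime in `(x/(8t^E), x/(4t^E)]` (Bertrand), so that `J = ⌊x/4ℓ⌋ ∈ [t^E, 2t^E]`
and `ℓ, q ≤ x/(log x)^u`. If the conclusion failed at `x`, `𝒜` would be `c`-regular to both moduli
`ℓ` and `q`, and `maierMatrix_bounds` (Proposition 2.2) gives `|Φ_q(J) q/φ(q) - J| ≤ 30cJ` for
the number `Φ_q(J)` of `j ≤ J` coprime to `q`. On the other hand `J ≤ (t^a)^{N+1}` and
`∑_{t^a<p≤t^b} 1/p → κ` (Mertens' second theorem with its constant, tree
`Literature.NumberTheory.LFunctions.Mertens.tendsto_primeRecipSum_sub_loglog`), so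
`roughCount_deviation` gives `|Φ_q(J) - J φ(q)/q| ≥ δ₁ J - (2t^b)^N`; since `J ≥ t^E = t^{bN} t^{N+1}`
the two are incompatible once `t^{N+1} > 2^N/(0.7 δ₁)`.

## Contents (all proved; theorems only)

* `sum_inv_primes_window`: `∑_{t^a < p ≤ t^b} 1/p → log(b/a)`;
* parameter bookkeeping: `floor_rpow_inv_facts`, `prod_primes_window_le_four_pow`,
  `mem_primes_window`, `eventually_large_x`, `eventually_large_t`, `exists_bertrand_prime`,
  `t_pow_facts`, `q_facts`, `coprime_prod_primes_window`, `bertrand_input`, `ell_facts`,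
  `t_threshold_facts`;
* `sieve_side_contradiction` (the sieve side against the matrix bound);
* `EquidistributionLimitBarrier_holds`.
-/

noncomputable section

open Finset Filter

namespace Literature.Barriers.Parity

/-- `Φ(J; P) = #{1 ≤ j ≤ J : p ∤ j for every p ∈ P}` (as in `EquidistributionLimitsSieve.lean`). -/
local notation3 "Φ(" J "; " P ")" =>
  Finset.card (Finset.filter (fun j => ∀ p ∈ P, ¬ p ∣ j) (Finset.Icc 1 J))

/-- The sieving primes `Pr(t, N) = {p prime : t^{4N+3} < p ≤ t^{4N+4}}`. -/
local notation3 "Pr(" t ", " N ")" => Nat.primesLE (t ^ (4 * N + 4)) \ Nat.primesLE (t ^ (4 * N + 3))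

/-! ### Mertens: reciprocal sums of the primes in `(t^a, t^b]` -/

/-- **Reciprocal sum over a window** (from Mertens' second theorem with its constant):
for `1 ≤ a ≤ b`, `∑_{t^a < p ≤ t^b} 1/p → log(b/a)` as `t → ∞`; here with an explicit `ε`.
[cite: HardyWright2008, Thm 427–428 (§22.7–22.8)] -/
theorem sum_inv_primes_window {a b : ℕ} (ha : 1 ≤ a) (hab : a ≤ b) {ε : ℝ} (hε : 0 < ε) :
    ∃ t₀ : ℕ, ∀ t : ℕ, t₀ ≤ t →
      |∑ p ∈ Nat.primesLE (t ^ b) \ Nat.primesLE (t ^ a), (p : ℝ)⁻¹ - Real.log ((b : ℝ) / a)| ≤ ε := by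
  have hM := Literature.NumberTheory.LFunctions.Mertens.tendsto_primeRecipSum_sub_loglog
  have hev := (Metric.tendsto_nhds.mp hM) (ε / 2) (by positivity)
  rw [Filter.eventually_atTop] at hev
  obtain ⟨X₀, hX₀⟩ := hev
  refine ⟨max ⌈X₀⌉₊ 2, fun t ht => ?_⟩
  have ht2 : 2 ≤ t := le_of_max_le_right ht
  have htX : X₀ ≤ t := (Nat.le_ceil X₀).trans (by exact_mod_cast le_of_max_le_left ht)
  have ht1 : (1 : ℝ) < t := by exact_mod_cast (by omega : 1 < t)
  have ha0 : (0 : ℝ) < a := by exact_mod_cast ha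
  have hb0 : (0 : ℝ) < b := by exact_mod_cast (ha.trans hab)
  have hta : X₀ ≤ ((t ^ a : ℕ) : ℝ) := htX.trans (by exact_mod_cast Nat.le_self_pow (by omega) t)
  have htb : X₀ ≤ ((t ^ b : ℕ) : ℝ) := htX.trans (by exact_mod_cast Nat.le_self_pow (by omega) t)
  have ea := hX₀ _ hta
  have eb := hX₀ _ htb
  rw [Real.dist_eq] at ea eb
  have hpr : ∀ n : ℕ, Literature.NumberTheory.LFunctions.Mertens.primeRecipSum (n : ℝ) =
      ∑ p ∈ Nat.primesLE n, (p : ℝ)⁻¹ := by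
    intro n
    simp [Literature.NumberTheory.LFunctions.Mertens.primeRecipSum, Nat.floor_natCast]
  rw [hpr] at ea eb
  have hsub : Nat.primesLE (t ^ a) ⊆ Nat.primesLE (t ^ b) :=
    Nat.primesLE_mono (Nat.pow_le_pow_right (by omega) hab)
  have hdiff : ∑ p ∈ Nat.primesLE (t ^ b) \ Nat.primesLE (t ^ a), (p : ℝ)⁻¹ =
      ∑ p ∈ Nat.primesLE (t ^ b), (p : ℝ)⁻¹ - ∑ p ∈ Nat.primesLE (t ^ a), (p : ℝ)⁻¹ := by
    rw [← Finset.sum_sdiff hsub]; ring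
  have hlogt : 0 < Real.log t := Real.log_pos ht1
  have hll : Real.log (Real.log ((t ^ b : ℕ) : ℝ)) - Real.log (Real.log ((t ^ a : ℕ) : ℝ)) =
      Real.log ((b : ℝ) / a) := by
    push_cast
    rw [Real.log_pow, Real.log_pow, Real.log_mul hb0.ne' hlogt.ne', Real.log_mul ha0.ne' hlogt.ne',
      Real.log_div hb0.ne' ha0.ne']
    ring
  rw [hdiff, abs_le]
  rw [abs_lt] at ea eb
  constructor <;> linarith [hll]

/-! ### Elementary facts about the parameters -/

/-- For `t = ⌊y^{1/b}⌋`: `t^b ≤ y < (t+1)^b`. [folklore] -/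
theorem floor_rpow_inv_facts {y : ℝ} (hy : 0 ≤ y) {b : ℕ} (hb : b ≠ 0) :
    ((⌊y ^ ((b : ℝ)⁻¹)⌋₊ : ℕ) : ℝ) ^ b ≤ y ∧ y < (((⌊y ^ ((b : ℝ)⁻¹)⌋₊ : ℕ) : ℝ) + 1) ^ b := by
  have h0 : 0 ≤ y ^ ((b : ℝ)⁻¹) := Real.rpow_nonneg hy _
  constructor
  · calc ((⌊y ^ ((b : ℝ)⁻¹)⌋₊ : ℕ) : ℝ) ^ b ≤ (y ^ ((b : ℝ)⁻¹)) ^ b :=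
          pow_le_pow_left₀ (Nat.cast_nonneg _) (Nat.floor_le h0) b
      _ = y := Real.rpow_inv_natCast_pow hy hb
  · calc y = (y ^ ((b : ℝ)⁻¹)) ^ b := (Real.rpow_inv_natCast_pow hy hb).symm
      _ < _ := pow_lt_pow_left₀ (Nat.lt_floor_add_one _) h0 hb

/-- The sieving modulus is bounded by the primorial: `∏_{t^a < p ≤ t^b} p ≤ 4^{t^b}` (Chebyshev).
[folklore] -/
theorem prod_primes_window_le_four_pow (t N : ℕ) : ∏ p ∈ Pr(t, N), p ≤ 4 ^ (t ^ (4 * N + 4)) :=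
  calc ∏ p ∈ Pr(t, N), p ≤ ∏ p ∈ Nat.primesLE (t ^ (4 * N + 4)), p :=
        Finset.prod_le_prod_of_subset_of_one_le' sdiff_subset fun _ hp _ =>
          (Nat.prime_of_mem_primesLE hp).one_le
    _ = primorial (t ^ (4 * N + 4)) := rfl
    _ ≤ 4 ^ (t ^ (4 * N + 4)) := primorial_le_four_pow _

/-- Members of `Pr(t, N)` are primes in `(t^{4N+3}, t^{4N+4}]`. [folklore] -/
theorem mem_primes_window {t N p : ℕ} (hp : p ∈ Pr(t, N)) :
    p.Prime ∧ t ^ (4 * N + 3) < p ∧ p ≤ t ^ (4 * N + 4) := by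
  obtain ⟨h1, h2⟩ := mem_sdiff.mp hp
  obtain ⟨hle, hpr⟩ := Nat.mem_primesLE.mp h1
  refine ⟨hpr, ?_, hle⟩
  by_contra hcon
  exact h2 (Nat.mem_primesLE.mpr ⟨not_lt.mp hcon, hpr⟩)

/-! ### The sieve side: incompatibility with the matrix bound -/

/-- **The contradiction.** With `P = Pr(t, N)`, `q = ∏_P p`, `s = ∑_P 1/p ∈ [¾κ, 5κ/4]`,
`(N+1)/t^{4N+3} ≤ κ/4`, `J ∈ [t^E, 2t^E]` (`E = (4N+4)N + N + 1`), `δ₁ = (κ/2)^{N+1}/(2(N+1)!)`,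
`c = δ₁/100` and `t > 2^N/(0.7 δ₁)`, the matrix bound `|Φ_q(J) q/φ(q) - J| ≤ 30 c J` is impossible:
`roughCount_deviation` gives `|Φ_q(J) - Jφ(q)/q| ≥ δ₁ J - (2 t^{4N+4})^N` while
`J ≥ t^{(4N+4)N} t^{N+1}`. [cite: GranvilleSoundararajan2007Uncertainty, §2 (deduction of Corollary 1.3 from Proposition 2.2)] -/
theorem sieve_side_contradiction {N t J : ℕ} {κ δ₁ c : ℝ} (ht : 2 ≤ t) (hκ0 : 0 < κ)
    (hκ1 : κ ≤ 4 / 5) (hδ₁ : δ₁ = (κ / 2) ^ (N + 1) / (2 * ((N + 1).factorial : ℝ)))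
    (hc : c = δ₁ / 100)
    (hs1 : 3 / 4 * κ ≤ ∑ p ∈ Pr(t, N), (p : ℝ)⁻¹) (hs2 : ∑ p ∈ Pr(t, N), (p : ℝ)⁻¹ ≤ 5 / 4 * κ)
    (hta : ((N : ℝ) + 1) / (t : ℝ) ^ (4 * N + 3) ≤ κ / 4)
    (hJ1 : t ^ ((4 * N + 4) * N + N + 1) ≤ J) (hJ2 : J ≤ 2 * t ^ ((4 * N + 4) * N + N + 1))
    (htbig : (2 : ℝ) ^ N < 7 / 10 * δ₁ * t)
    (hmat : |(#{j ∈ Icc 1 J | Nat.Coprime j (∏ p ∈ Pr(t, N), p)} : ℝ) * (∏ p ∈ Pr(t, N), p : ℕ) /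
        (Nat.totient (∏ p ∈ Pr(t, N), p) : ℝ) - J| ≤ 30 * c * J) : False := by
  have hPprime : ∀ p ∈ Pr(t, N), p.Prime := fun p hp => (mem_primes_window hp).1
  have hPgt : ∀ p ∈ Pr(t, N), t ^ (4 * N + 3) < p := fun p hp => (mem_primes_window hp).2.1
  have ht0 : 0 < t := by omega
  have htR : (2 : ℝ) ≤ t := by exact_mod_cast ht
  -- coprime ↔ rough
  have hΦ : #{j ∈ Icc 1 J | Nat.Coprime j (∏ p ∈ Pr(t, N), p)} = Φ(J; Pr(t, N)) :=
    congrArg Finset.card (filter_congr fun j _ => coprime_prod_primes_iff hPprime j)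
  rw [hΦ] at hmat
  -- `q > 0`, `0 < φ(q)/q ≤ 1`, `φ(q)/q = ∏ (1 - 1/p)`
  have hqpos : 0 < ∏ p ∈ Pr(t, N), p := prod_pos fun p hp => (hPprime p hp).pos
  have hqR : (0 : ℝ) < ((∏ p ∈ Pr(t, N), p : ℕ) : ℝ) := by exact_mod_cast hqpos
  have hφpos : (0 : ℝ) < (Nat.totient (∏ p ∈ Pr(t, N), p) : ℝ) := by
    exact_mod_cast Nat.totient_pos.mpr hqpos
  have hφle : (Nat.totient (∏ p ∈ Pr(t, N), p) : ℝ) ≤ ((∏ p ∈ Pr(t, N), p : ℕ) : ℝ) := by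
    exact_mod_cast Nat.totient_le _
  have hEuler := totient_prod_primes_div hPprime
  -- `|Φ - J φ(q)/q| ≤ |Φ q/φ(q) - J|`
  set Φr : ℝ := (Φ(J; Pr(t, N)) : ℝ) with hΦr
  set qr : ℝ := ((∏ p ∈ Pr(t, N), p : ℕ) : ℝ) with hqr
  set φr : ℝ := (Nat.totient (∏ p ∈ Pr(t, N), p) : ℝ) with hφr
  have hdev1 : |Φr - J * ∏ p ∈ Pr(t, N), (1 - (p : ℝ)⁻¹)| ≤ 30 * c * J := by
    rw [← hEuler]
    have hid : Φr - J * (φr / qr) = (Φr * qr / φr - J) * (φr / qr) := by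
      field_simp
    rw [hid, abs_mul, abs_of_pos (div_pos hφpos hqR)]
    calc |Φr * qr / φr - J| * (φr / qr) ≤ |Φr * qr / φr - J| * 1 :=
          mul_le_mul_of_nonneg_left ((div_le_one hqR).mpr hφle) (abs_nonneg _)
      _ = _ := by rw [mul_one]
      _ ≤ 30 * c * J := hmat
  -- the sieve deviation with `w = t^a`
  have hs0 : ∑ p ∈ Pr(t, N), (p : ℝ)⁻¹ ≤ 1 := by linarith
  have hw1 : 1 ≤ t ^ (4 * N + 3) := Nat.one_le_pow _ _ ht0
  have hJw : J ≤ (t ^ (4 * N + 3)) ^ (N + 1) := by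
    have hexp : (4 * N + 3) * (N + 1) = ((4 * N + 4) * N + N + 1) + (2 * N + 2) := by ring
    rw [← pow_mul, hexp, pow_add]
    calc J ≤ 2 * t ^ ((4 * N + 4) * N + N + 1) := hJ2
      _ = t ^ ((4 * N + 4) * N + N + 1) * 2 := by ring
      _ ≤ t ^ ((4 * N + 4) * N + N + 1) * t ^ (2 * N + 2) := by
          refine Nat.mul_le_mul_left _ ?_
          calc 2 ≤ t := ht
            _ ≤ t ^ (2 * N + 2) := Nat.le_self_pow (by omega) t
  have hNw : ((N : ℝ) + 1) / ((t ^ (4 * N + 3) : ℕ) : ℝ) ≤ ∑ p ∈ Pr(t, N), (p : ℝ)⁻¹ := by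
    push_cast; linarith
  have hdev2 := roughCount_deviation hPprime hw1 hPgt hJw hs0 hNw (N := N)
  push_cast at hdev2
  -- lower bound of the main term by `δ₁ J`
  have hbase : κ / 2 ≤ ∑ p ∈ Pr(t, N), (p : ℝ)⁻¹ - ((N : ℝ) + 1) / (t : ℝ) ^ (4 * N + 3) := by
    linarith
  have hpow : (κ / 2) ^ (N + 1) ≤
      (∑ p ∈ Pr(t, N), (p : ℝ)⁻¹ - ((N : ℝ) + 1) / (t : ℝ) ^ (4 * N + 3)) ^ (N + 1) :=
    pow_le_pow_left₀ (by positivity) hbase _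
  have hfpos : (0 : ℝ) < ((N + 1).factorial : ℝ) := by exact_mod_cast Nat.factorial_pos _
  have hJ0 : (0 : ℝ) ≤ J := Nat.cast_nonneg J
  have hmain : (J : ℝ) * δ₁ ≤ (J : ℝ) *
      ((∑ p ∈ Pr(t, N), (p : ℝ)⁻¹ - ((N : ℝ) + 1) / (t : ℝ) ^ (4 * N + 3)) ^ (N + 1) /
        (2 * ((N + 1).factorial : ℝ))) := by
    refine mul_le_mul_of_nonneg_left ?_ hJ0
    rw [hδ₁]
    exact div_le_div_of_nonneg_right hpow (by positivity)
  -- `#P + 1 ≤ 2 t^b`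
  have hcardP : ((#(Pr(t, N)) : ℝ) + 1) ≤ 2 * (t : ℝ) ^ (4 * N + 4) := by
    have h1 : #(Pr(t, N)) ≤ t ^ (4 * N + 4) + 1 := by
      calc #(Pr(t, N)) ≤ #(Nat.primesLE (t ^ (4 * N + 4))) := card_le_card sdiff_subset
        _ ≤ #(range (t ^ (4 * N + 4) + 1)) := by
            rw [Nat.primesLE_eq_filter_range]; exact card_filter_le _ _
        _ = t ^ (4 * N + 4) + 1 := card_range _
    have h1' : (#(Pr(t, N)) : ℝ) ≤ (t : ℝ) ^ (4 * N + 4) + 1 := by exact_mod_cast h1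
    have h2 : (2 : ℝ) ≤ (t : ℝ) ^ (4 * N + 4) :=
      htR.trans (by exact_mod_cast Nat.le_self_pow (by omega) t)
    linarith
  have hDN : ((#(Pr(t, N)) : ℝ) + 1) ^ N ≤ (2 : ℝ) ^ N * ((t : ℝ) ^ (4 * N + 4)) ^ N := by
    rw [← mul_pow]; exact pow_le_pow_left₀ (by positivity) hcardP N
  -- `J ≥ t^E = (t^b)^N t^{N+1}`
  have hJlow : ((t : ℝ) ^ (4 * N + 4)) ^ N * (t : ℝ) ^ (N + 1) ≤ J := by
    have : (((t ^ ((4 * N + 4) * N + N + 1) : ℕ) : ℝ)) ≤ J := by exact_mod_cast hJ1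
    push_cast at this
    calc ((t : ℝ) ^ (4 * N + 4)) ^ N * (t : ℝ) ^ (N + 1) = (t : ℝ) ^ ((4 * N + 4) * N + N + 1) := by
          rw [← pow_mul, ← pow_add]; ring_nf
      _ ≤ J := this
  -- combine: `0.7 δ₁ J ≤ (#P+1)^N ≤ 2^N (t^b)^N` and `J ≥ (t^b)^N t^{N+1}`, `t^{N+1} ≥ t`
  have hδ₁0 : 0 < δ₁ := by rw [hδ₁]; positivity
  have hcomb : 7 / 10 * δ₁ * J ≤ (2 : ℝ) ^ N * ((t : ℝ) ^ (4 * N + 4)) ^ N := by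
    have := hdev2.trans hdev1
    rw [hc] at this
    nlinarith
  have htb0 : (0 : ℝ) < ((t : ℝ) ^ (4 * N + 4)) ^ N := by positivity
  have htN : (t : ℝ) ≤ (t : ℝ) ^ (N + 1) := by
    exact_mod_cast Nat.le_self_pow (by omega) t
  have hfinal : 7 / 10 * δ₁ * ((t : ℝ) ^ (N + 1)) ≤ (2 : ℝ) ^ N := by
    have h := (mul_le_mul_of_nonneg_left hJlow (by positivity : (0 : ℝ) ≤ 7 / 10 * δ₁)).trans hcomb
    have h' : 7 / 10 * δ₁ * (t : ℝ) ^ (N + 1) * ((t : ℝ) ^ (4 * N + 4)) ^ N ≤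
        (2 : ℝ) ^ N * ((t : ℝ) ^ (4 * N + 4)) ^ N := by linarith
    exact le_of_mul_le_mul_right h' htb0
  nlinarith

/-! ### Thresholds -/

/-- The conditions on `x` used in the proof hold for all large `x`. [folklore] -/
theorem eventually_large_x (N : ℕ) {u γ : ℝ} (hγ : 0 < γ) (hγu : (N : ℝ) + 1 / 4 = u + γ)
    (C₂ C₆ : ℝ) {C₇ : ℝ} (hC₇ : 0 < C₇) (c : ℝ) :
    ∀ᶠ x : ℝ in atTop,
      C₂ ≤ Real.log x ∧
      Real.log x ^ u ≤ x ^ (1 - Real.log 2) ∧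
      12 / c ≤ x ^ (1 - Real.log 2) ∧
      Real.log x ^ u * C₆ ≤ 4 * Real.log x ^ ((N : ℝ) + 1 / 4) ∧
      C₇ * Real.log x ^ (N + 2) ≤ x := by
  have hs : 0 < 1 - Real.log 2 := by linarith [Real.log_two_lt_d9]
  have h1 : ∀ᶠ x : ℝ in atTop, C₂ ≤ Real.log x := Real.tendsto_log_atTop.eventually_ge_atTop C₂
  have h2 : ∀ᶠ x : ℝ in atTop, Real.log x ^ u ≤ x ^ (1 - Real.log 2) := by
    have hlo := (isLittleO_log_rpow_rpow_atTop u hs).bound one_pos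
    filter_upwards [hlo, eventually_ge_atTop 1] with x hx hx1
    have hl : 0 ≤ Real.log x := Real.log_nonneg hx1
    rw [one_mul, Real.norm_eq_abs, Real.norm_eq_abs, abs_of_nonneg (Real.rpow_nonneg hl u),
      abs_of_nonneg (Real.rpow_nonneg (by linarith) _)] at hx
    exact hx
  have h3 : ∀ᶠ x : ℝ in atTop, 12 / c ≤ x ^ (1 - Real.log 2) :=
    (tendsto_rpow_atTop hs).eventually_ge_atTop _
  have h4 : ∀ᶠ x : ℝ in atTop, Real.log x ^ u * C₆ ≤ 4 * Real.log x ^ ((N : ℝ) + 1 / 4) := by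
    have hev := ((tendsto_rpow_atTop hγ).comp Real.tendsto_log_atTop).eventually_ge_atTop (C₆ / 4)
    filter_upwards [hev, eventually_gt_atTop 1] with x hx hx1
    have hl : 0 < Real.log x := Real.log_pos hx1
    simp only [Function.comp_apply] at hx
    rw [hγu, Real.rpow_add hl]
    have hu0 : 0 ≤ Real.log x ^ u := Real.rpow_nonneg hl.le u
    nlinarith
  have h5 : ∀ᶠ x : ℝ in atTop, C₇ * Real.log x ^ (N + 2) ≤ x := by
    have hlo := (isLittleO_log_rpow_rpow_atTop ((N : ℝ) + 2) one_pos).bound (inv_pos.mpr hC₇)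
    filter_upwards [hlo, eventually_ge_atTop 1] with x hx hx1
    have hl : 0 ≤ Real.log x := Real.log_nonneg hx1
    rw [Real.rpow_one, Real.norm_eq_abs, Real.norm_eq_abs, abs_of_nonneg (Real.rpow_nonneg hl _),
      abs_of_nonneg (by linarith : (0 : ℝ) ≤ x)] at hx
    have hnat : Real.log x ^ ((N : ℝ) + 2) = Real.log x ^ (N + 2) := by
      rw [← Real.rpow_natCast]; push_cast; ring_nf
    rw [hnat] at hx
    have := mul_le_mul_of_nonneg_left hx hC₇.le
    rw [← mul_assoc, mul_inv_cancel₀ hC₇.ne', one_mul] at this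
    exact this
  exact h1.and (h2.and (h3.and (h4.and h5)))

/-- The conditions on `t` used in the proof hold for all large `t`. [folklore] -/
theorem eventually_large_t (t₁ : ℕ) (A B C : ℝ) :
    ∀ᶠ t : ℕ in atTop, t₁ ≤ t ∧ 2 ≤ t ∧ A ≤ t ∧ B ≤ t ∧ C < t :=
  (eventually_ge_atTop t₁).and <| (eventually_ge_atTop 2).and <|
    (tendsto_natCast_atTop_atTop.eventually_ge_atTop A).and <|
      (tendsto_natCast_atTop_atTop.eventually_ge_atTop B).and
        (tendsto_natCast_atTop_atTop.eventually_gt_atTop C)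

/-- **Bertrand step**: for `T ≥ 1` and `1 ≤ B ≤ x/(8T)` there is a prime `ℓ` with `B < ℓ`,
`x/(8T) < ℓ ≤ x/(4T)`, hence `T ≤ ⌊x/4ℓ⌋ ≤ 2T`. [folklore] -/
theorem exists_bertrand_prime {x : ℝ} {T B : ℕ} (hT : 0 < T) (hB : 1 ≤ B)
    (hx : (B : ℝ) ≤ x / (8 * T)) :
    ∃ ℓ : ℕ, ℓ.Prime ∧ B < ℓ ∧ x / (8 * T) < ℓ ∧ (ℓ : ℝ) ≤ x / (4 * T) ∧
      T ≤ ⌊x / (4 * ℓ)⌋₊ ∧ ⌊x / (4 * ℓ)⌋₊ ≤ 2 * T := by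
  have hTpos : (0 : ℝ) < T := by exact_mod_cast hT
  have hB1 : (1 : ℝ) ≤ B := by exact_mod_cast hB
  have hxpos : 0 < x := by
    have h1 : (1 : ℝ) ≤ x / (8 * T) := hB1.trans hx
    rw [le_div_iff₀ (by positivity)] at h1
    linarith
  set n : ℕ := ⌊x / (8 * T)⌋₊ with hn_def
  have hn : B ≤ n := Nat.le_floor hx
  obtain ⟨ℓ, hℓp, hnℓ, hℓ2n⟩ := Nat.exists_prime_lt_and_le_two_mul n (by omega)
  have hnle : (n : ℝ) ≤ x / (8 * T) := Nat.floor_le (by positivity)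
  have hnlt : x / (8 * T) < n + 1 := Nat.lt_floor_add_one _
  have hℓlo : x / (8 * T) < ℓ := hnlt.trans_le (by exact_mod_cast hnℓ)
  have hℓhi : (ℓ : ℝ) ≤ x / (4 * T) := by
    have h1 : (ℓ : ℝ) ≤ 2 * n := by exact_mod_cast hℓ2n
    have h2 : 2 * (x / (8 * T)) = x / (4 * T) := by field_simp; ring
    linarith
  have hℓpos : (0 : ℝ) < ℓ := by exact_mod_cast hℓp.pos
  refine ⟨ℓ, hℓp, lt_of_le_of_lt hn hnℓ, hℓlo, hℓhi, ?_, ?_⟩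
  · refine Nat.le_floor ?_
    rw [le_div_iff₀ (by positivity)]
    rw [le_div_iff₀ (by positivity)] at hℓhi
    linarith
  · refine Nat.floor_le_of_le ?_
    rw [div_le_iff₀ (by positivity)]
    rw [div_lt_iff₀ (by positivity)] at hℓlo
    push_cast
    linarith

/-! ### The parameters at scale `x` -/

/-- Facts about `t = ⌊(log x / 2)^{1/b}⌋`, `b = 4N+4`, `E = bN+N+1` (so `E/b = N + 1/4`):
`t ≥ 1`, `t^b ≤ log x/2 < (t+1)^b`, `t^E ≤ (log x)^{N+1}` and
`(log x)^{N+1/4} ≤ (2^{b+1})^{N+1/4} t^E`. [folklore] -/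
theorem t_pow_facts (N : ℕ) {x : ℝ} (hlogx : 2 ≤ Real.log x) {t : ℕ}
    (ht : t = ⌊(Real.log x / 2) ^ (((4 * N + 4 : ℕ) : ℝ)⁻¹)⌋₊) :
    1 ≤ t ∧ (t : ℝ) ^ (4 * N + 4) ≤ Real.log x / 2 ∧
      Real.log x / 2 < ((t : ℝ) + 1) ^ (4 * N + 4) ∧
      (t : ℝ) ^ ((4 * N + 4) * N + N + 1) ≤ Real.log x ^ (N + 1) ∧
      Real.log x ^ ((N : ℝ) + 1 / 4) ≤
        ((2 : ℝ) ^ (4 * N + 5)) ^ ((N : ℝ) + 1 / 4) * (t : ℝ) ^ ((4 * N + 4) * N + N + 1) := by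
  set y : ℝ := Real.log x / 2 with hy
  have hy1 : 1 ≤ y := by rw [hy]; linarith
  have hy0 : 0 ≤ y := by linarith
  have hylog : y ≤ Real.log x := by rw [hy]; linarith
  have hlog0 : 0 < Real.log x := by linarith
  have hb : (4 * N + 4 : ℕ) ≠ 0 := by omega
  have hbpos : (0 : ℝ) < ((4 * N + 4 : ℕ) : ℝ) := by positivity
  obtain ⟨htb_le, htb_gt⟩ := floor_rpow_inv_facts hy0 hb
  rw [← ht] at htb_le htb_gt
  have ht_le : (t : ℝ) ≤ y ^ (((4 * N + 4 : ℕ) : ℝ)⁻¹) := by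
    rw [ht]; exact Nat.floor_le (Real.rpow_nonneg hy0 _)
  have ht1 : 1 ≤ t := by
    rw [ht]
    exact Nat.le_floor (by simpa using Real.one_le_rpow hy1 (inv_nonneg.mpr hbpos.le))
  have htpos : (0 : ℝ) < t := by exact_mod_cast ht1
  have hE : (4 * (N : ℝ) + 4)⁻¹ * ((4 * N + 4) * N + N + 1) = (N : ℝ) + 1 / 4 := by
    have : (4 * (N : ℝ) + 4) ≠ 0 := by positivity
    field_simp
    ring
  have ht1R : (1 : ℝ) ≤ t := by exact_mod_cast ht1
  -- `(v^{1/b})^E = v^{N+1/4}` for `v ≥ 0`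
  have hroot : ∀ v : ℝ, 0 ≤ v →
      (v ^ (((4 * N + 4 : ℕ) : ℝ)⁻¹)) ^ ((4 * N + 4) * N + N + 1) = v ^ ((N : ℝ) + 1 / 4) := by
    intro v hv
    rw [← Real.rpow_natCast, ← Real.rpow_mul hv, ← hE]
    push_cast
    ring_nf
  refine ⟨ht1, htb_le, htb_gt, ?_, ?_⟩
  · -- `t^E ≤ y^{N+1/4} ≤ y^{N+1} ≤ (log x)^{N+1}`
    have h1 : (t : ℝ) ^ ((4 * N + 4) * N + N + 1) ≤
        (y ^ (((4 * N + 4 : ℕ) : ℝ)⁻¹)) ^ ((4 * N + 4) * N + N + 1) :=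
      pow_le_pow_left₀ (Nat.cast_nonneg _) ht_le _
    rw [hroot y hy0] at h1
    have h3 : y ^ ((N : ℝ) + 1 / 4) ≤ y ^ ((N : ℝ) + 1) :=
      Real.rpow_le_rpow_of_exponent_le hy1 (by linarith)
    have h4 : y ^ ((N : ℝ) + 1) = y ^ (N + 1) := by
      rw [← Real.rpow_natCast]; push_cast; ring_nf
    have h5 : y ^ (N + 1) ≤ Real.log x ^ (N + 1) := pow_le_pow_left₀ hy0 hylog _
    linarith
  · -- `t^b > y/2^b = log x / 2^{b+1}`, take roots and powers
    have h1 : ((t : ℝ) + 1) ^ (4 * N + 4) ≤ (2 * (t : ℝ)) ^ (4 * N + 4) :=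
      pow_le_pow_left₀ (by positivity) (by linarith) _
    rw [mul_pow] at h1
    set z : ℝ := Real.log x / (2 : ℝ) ^ (4 * N + 5) with hz
    have hz0 : 0 ≤ z := by positivity
    have h2 : z < (t : ℝ) ^ (4 * N + 4) := by
      rw [hz, div_lt_iff₀ (by positivity)]
      have h3 : y < (2 : ℝ) ^ (4 * N + 4) * (t : ℝ) ^ (4 * N + 4) := htb_gt.trans_le h1
      rw [hy, div_lt_iff₀ (by norm_num : (0 : ℝ) < 2)] at h3
      have h2' : (2 : ℝ) ^ (4 * N + 5) = 2 ^ (4 * N + 4) * 2 := by ring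
      rw [h2']
      linarith
    have h4 : z ^ (((4 * N + 4 : ℕ) : ℝ)⁻¹) < t := by
      have := Real.rpow_lt_rpow hz0 h2 (inv_pos.mpr hbpos)
      rwa [Real.pow_rpow_inv_natCast htpos.le hb] at this
    have h5 : (z ^ (((4 * N + 4 : ℕ) : ℝ)⁻¹)) ^ ((4 * N + 4) * N + N + 1) ≤
        (t : ℝ) ^ ((4 * N + 4) * N + N + 1) :=
      pow_le_pow_left₀ (Real.rpow_nonneg hz0 _) h4.le _
    rw [hroot z hz0, hz, Real.div_rpow hlog0.le (by positivity)] at h5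
    have hC₆ : (0 : ℝ) < ((2 : ℝ) ^ (4 * N + 5)) ^ ((N : ℝ) + 1 / 4) := by positivity
    rw [div_le_iff₀ hC₆] at h5
    linarith

/-- Facts about the sieving modulus `q = ∏_{t^{4N+3} < p ≤ t^{4N+4}} p` at scale `x`:
`q ≥ 1`, `q ≤ 4^{t^{4N+4}} ≤ x^{log 2} ≤ x/(log x)^u` and `12 q ≤ c x`, given
`t^{4N+4} ≤ log x/2`, `(log x)^u ≤ x^{1 - log 2}` and `12/c ≤ x^{1 - log 2}`. [folklore] -/
theorem q_facts (N t : ℕ) {x u c : ℝ} (hx0 : 0 < x) (hlog0 : 0 < Real.log x)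
    (htb : (t : ℝ) ^ (4 * N + 4) ≤ Real.log x / 2)
    (hX3 : Real.log x ^ u ≤ x ^ (1 - Real.log 2)) (hX4 : 12 / c ≤ x ^ (1 - Real.log 2))
    (hc0 : 0 < c) :
    1 ≤ ∏ p ∈ Pr(t, N), p ∧ ((∏ p ∈ Pr(t, N), p : ℕ) : ℝ) ≤ x / Real.log x ^ u ∧
      12 * ((∏ p ∈ Pr(t, N), p : ℕ) : ℝ) ≤ c * x := by
  have hPprime : ∀ p ∈ Pr(t, N), p.Prime := fun p hp => (mem_primes_window hp).1
  have hqpos : 0 < ∏ p ∈ Pr(t, N), p := prod_pos fun p hp => (hPprime p hp).pos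
  have hqx2 : ((∏ p ∈ Pr(t, N), p : ℕ) : ℝ) ≤ x ^ Real.log 2 := by
    have h1 : ((∏ p ∈ Pr(t, N), p : ℕ) : ℝ) ≤ ((4 ^ (t ^ (4 * N + 4)) : ℕ) : ℝ) := by
      exact_mod_cast prod_primes_window_le_four_pow t N
    have h2 : ((4 ^ (t ^ (4 * N + 4)) : ℕ) : ℝ) = (4 : ℝ) ^ (((t ^ (4 * N + 4) : ℕ) : ℝ)) := by
      rw [Real.rpow_natCast]; push_cast; ring
    have h3 : (4 : ℝ) ^ (((t ^ (4 * N + 4) : ℕ) : ℝ)) ≤ (4 : ℝ) ^ (Real.log x / 2) := by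
      refine Real.rpow_le_rpow_of_exponent_le (by norm_num) ?_
      push_cast
      exact htb
    have h4 : (4 : ℝ) ^ (Real.log x / 2) = x ^ Real.log 2 := by
      rw [Real.rpow_def_of_pos (by norm_num : (0 : ℝ) < 4), Real.rpow_def_of_pos hx0]
      have : Real.log 4 = 2 * Real.log 2 := by
        rw [show (4 : ℝ) = 2 ^ 2 by norm_num, Real.log_pow]; push_cast; ring
      rw [this]
      ring_nf
    calc ((∏ p ∈ Pr(t, N), p : ℕ) : ℝ) ≤ ((4 ^ (t ^ (4 * N + 4)) : ℕ) : ℝ) := h1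
      _ = (4 : ℝ) ^ (((t ^ (4 * N + 4) : ℕ) : ℝ)) := h2
      _ ≤ (4 : ℝ) ^ (Real.log x / 2) := h3
      _ = x ^ Real.log 2 := h4
  have hxsplit : x ^ (1 - Real.log 2) * x ^ Real.log 2 = x := by
    rw [← Real.rpow_add hx0]; simp
  have hxl0 : 0 < x ^ Real.log 2 := Real.rpow_pos_of_pos hx0 _
  refine ⟨hqpos, ?_, ?_⟩
  · refine hqx2.trans ?_
    rw [le_div_iff₀ (Real.rpow_pos_of_pos hlog0 u)]
    calc x ^ Real.log 2 * Real.log x ^ u ≤ x ^ Real.log 2 * x ^ (1 - Real.log 2) :=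
          mul_le_mul_of_nonneg_left hX3 hxl0.le
      _ = x := by rw [mul_comm, hxsplit]
  · have h1 : 12 / c * x ^ Real.log 2 ≤ x ^ (1 - Real.log 2) * x ^ Real.log 2 :=
      mul_le_mul_of_nonneg_right hX4 hxl0.le
    rw [hxsplit, div_mul_eq_mul_div, div_le_iff₀ hc0] at h1
    nlinarith

/-- A prime above the window is coprime to the sieving modulus. [folklore] -/
theorem coprime_prod_primes_window {ℓ t N : ℕ} (hℓp : ℓ.Prime) (hℓB : t ^ (4 * N + 4) < ℓ) :
    Nat.Coprime ℓ (∏ p ∈ Pr(t, N), p) := by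
  refine (Nat.Prime.coprime_iff_not_dvd hℓp).mpr fun hdvd => ?_
  obtain ⟨p, hp, hℓdvd⟩ := (Prime.dvd_finsetProd_iff hℓp.prime _).mp hdvd
  obtain ⟨hpp, -, hple⟩ := mem_primes_window hp
  have heq : ℓ = p := (Nat.prime_dvd_prime_iff_eq hℓp hpp).mp hℓdvd
  omega

/-- The input to the Bertrand step: `t^b ≤ x/(8 t^E)` once `8(1/c+1)(log x)^{N+2} ≤ x`.
[folklore] -/
theorem bertrand_input {N t : ℕ} {x c : ℝ} (hc0 : 0 < c) (hlog0 : 0 < Real.log x)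
    (ht1 : 1 ≤ t) (htE : (t : ℝ) ^ ((4 * N + 4) * N + N + 1) ≤ Real.log x ^ (N + 1))
    (htb : (t : ℝ) ^ (4 * N + 4) ≤ Real.log x)
    (hX7 : 8 * (1 / c + 1) * Real.log x ^ (N + 2) ≤ x) :
    (((t ^ (4 * N + 4) : ℕ)) : ℝ) ≤ x / (8 * ((t ^ ((4 * N + 4) * N + N + 1) : ℕ) : ℝ)) := by
  have htpos : (0 : ℝ) < t := by exact_mod_cast ht1
  push_cast
  rw [le_div_iff₀ (by positivity)]
  have hc' : (8 : ℝ) ≤ 8 * (1 / c + 1) := by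
    have : 0 < 1 / c := by positivity
    nlinarith
  calc (t : ℝ) ^ (4 * N + 4) * (8 * (t : ℝ) ^ ((4 * N + 4) * N + N + 1))
      = 8 * ((t : ℝ) ^ ((4 * N + 4) * N + N + 1) * (t : ℝ) ^ (4 * N + 4)) := by ring
    _ ≤ 8 * (Real.log x ^ (N + 1) * Real.log x) := by
        refine mul_le_mul_of_nonneg_left ?_ (by norm_num)
        exact mul_le_mul htE htb (by positivity) (by positivity)
    _ = 8 * Real.log x ^ (N + 2) := by ring
    _ ≤ 8 * (1 / c + 1) * Real.log x ^ (N + 2) :=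
        mul_le_mul_of_nonneg_right hc' (by positivity)
    _ ≤ x := hX7

/-- The size conditions on the Bertrand prime `ℓ ∈ (x/8t^E, x/4t^E]` required by
`maierMatrix_bounds`: `ℓ ≤ x/(log x)^u`, `c(ℓ - 1) ≥ 1`, `4ℓ ≤ cx`. [folklore] -/
theorem ell_facts {N t : ℕ} {x c u ℓ : ℝ} (hx0 : 0 < x) (hlog0 : 0 < Real.log x) (hc0 : 0 < c)
    (ht1 : 1 ≤ t) (ht4 : 1 / c ≤ t)
    (htE : (t : ℝ) ^ ((4 * N + 4) * N + N + 1) ≤ Real.log x ^ (N + 2))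
    (hX7 : 8 * (1 / c + 1) * Real.log x ^ (N + 2) ≤ x)
    (hlogu : Real.log x ^ u ≤ 4 * (t : ℝ) ^ ((4 * N + 4) * N + N + 1))
    (hℓlo : x / (8 * (t : ℝ) ^ ((4 * N + 4) * N + N + 1)) < ℓ)
    (hℓhi : ℓ ≤ x / (4 * (t : ℝ) ^ ((4 * N + 4) * N + N + 1))) :
    ℓ ≤ x / Real.log x ^ u ∧ 1 ≤ c * (ℓ - 1) ∧ 4 * ℓ ≤ c * x := by
  have htpos : (0 : ℝ) < t := by exact_mod_cast ht1
  have htEpos : (0 : ℝ) < (t : ℝ) ^ ((4 * N + 4) * N + N + 1) := by positivity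
  refine ⟨?_, ?_, ?_⟩
  · exact hℓhi.trans (div_le_div_of_nonneg_left hx0.le (Real.rpow_pos_of_pos hlog0 u) hlogu)
  · have h1 : 8 * (1 / c + 1) * (t : ℝ) ^ ((4 * N + 4) * N + N + 1) ≤ x :=
      le_trans (mul_le_mul_of_nonneg_left htE (by positivity)) hX7
    have h2 : 1 / c + 1 ≤ x / (8 * (t : ℝ) ^ ((4 * N + 4) * N + N + 1)) := by
      rw [le_div_iff₀ (by positivity)]; linarith
    have h3 : 1 / c ≤ ℓ - 1 := by linarith
    rw [div_le_iff₀ hc0] at h3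
    linarith
  · have h1 : 4 * ℓ ≤ x / (t : ℝ) ^ ((4 * N + 4) * N + N + 1) := by
      have := mul_le_mul_of_nonneg_left hℓhi (by norm_num : (0 : ℝ) ≤ 4)
      rwa [show (4 : ℝ) * (x / (4 * (t : ℝ) ^ ((4 * N + 4) * N + N + 1))) =
        x / (t : ℝ) ^ ((4 * N + 4) * N + N + 1) by field_simp] at this
    have h2 : 1 / c ≤ (t : ℝ) ^ ((4 * N + 4) * N + N + 1) :=
      ht4.trans (by exact_mod_cast Nat.le_self_pow (by omega) t)
    have h3 : x / (t : ℝ) ^ ((4 * N + 4) * N + N + 1) ≤ c * x := by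
      rw [div_le_iff₀ htEpos]
      rw [div_le_iff₀ hc0] at h2
      nlinarith
    exact h1.trans h3

/-- Consequences of the `t`-threshold: the window sum is in `[¾κ, 5κ/4]`, `(N+1)/t^a ≤ κ/4` and
`2^N < 0.7 δ₁ t`. [folklore] -/
theorem t_threshold_facts {N t : ℕ} {κ δ₁ S : ℝ} (hκ0 : 0 < κ) (hδ₁0 : 0 < δ₁) (ht2 : 2 ≤ t)
    (hwin : |S - κ| ≤ κ / 4) (ht3 : 4 * ((N : ℝ) + 1) / κ ≤ t)
    (ht5 : (2 : ℝ) ^ N / (7 / 10 * δ₁) < t) :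
    3 / 4 * κ ≤ S ∧ S ≤ 5 / 4 * κ ∧ ((N : ℝ) + 1) / (t : ℝ) ^ (4 * N + 3) ≤ κ / 4 ∧
      (2 : ℝ) ^ N < 7 / 10 * δ₁ * t := by
  have htpos : (0 : ℝ) < t := by exact_mod_cast (by omega : 0 < t)
  rw [abs_le] at hwin
  refine ⟨by linarith [hwin.1], by linarith [hwin.2], ?_, ?_⟩
  · have h1 : (t : ℝ) ≤ (t : ℝ) ^ (4 * N + 3) := by exact_mod_cast Nat.le_self_pow (by omega) t
    have h2 : ((N : ℝ) + 1) / (t : ℝ) ^ (4 * N + 3) ≤ ((N : ℝ) + 1) / t :=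
      div_le_div_of_nonneg_left (by positivity) htpos h1
    have h3 : ((N : ℝ) + 1) / t ≤ κ / 4 := by
      rw [div_le_iff₀ htpos]
      rw [div_le_iff₀ hκ0] at ht3
      linarith
    exact h2.trans h3
  · rw [div_lt_iff₀ (by positivity)] at ht5
    linarith

/-! ### The discharge -/

/-- **Discharge of `EquidistributionLimitBarrier`** (Granville–Soundararajan 2007, Example 4: every
subset of the primes has "Maier type" irregularities in arithmetic progressions to moduli
`ℓ ≤ x/(log x)^u`). The proof is described in the module docstring: Proposition 2.2 of the source
(`maierMatrix_bounds`) against the exact pure-sieve deviation (`roughCount_deviation`,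
`sieve_side_contradiction`) for `q = ∏_{t^{4N+3} < p ≤ t^{4N+4}} p`, `t = ⌊(log x/2)^{1/(4N+4)}⌋`,
`N = ⌊u⌋ + 1`, and a Bertrand prime `ℓ ∈ (x/8t^E, x/4t^E]`, `E = (4N+4)N+N+1`; the constant is
`c(u) = (log((4N+4)/(4N+3))/2)^{N+1} / (200 (N+1)!)`.
[cite: GranvilleSoundararajan2007Uncertainty, Example 4 (p. 4); §2 Proposition 2.2; deduction of Corollary 1.3] -/
theorem EquidistributionLimitBarrier_holds : EquidistributionLimitBarrier := by
  intro u hu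
  /- parameters depending on `u` -/
  obtain ⟨N, hN1, huN⟩ : ∃ N : ℕ, 1 ≤ N ∧ u < N :=
    ⟨⌊u⌋₊ + 1, by omega, by push_cast; exact Nat.lt_floor_add_one u⟩
  have hNR : (1 : ℝ) ≤ N := by exact_mod_cast hN1
  obtain ⟨κ, hκ⟩ : ∃ κ : ℝ, κ = Real.log (((4 * N + 4 : ℕ) : ℝ) / ((4 * N + 3 : ℕ) : ℝ)) := ⟨_, rfl⟩
  have ha0 : (0 : ℝ) < ((4 * N + 3 : ℕ) : ℝ) := by positivity
  have hb0 : (0 : ℝ) < ((4 * N + 4 : ℕ) : ℝ) := by positivity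
  have hκ0 : 0 < κ := by
    rw [hκ]
    refine Real.log_pos ?_
    rw [one_lt_div ha0]
    push_cast
    linarith
  have hκ1 : κ ≤ 4 / 5 := by
    rw [hκ]
    have h := Real.log_le_sub_one_of_pos (div_pos hb0 ha0)
    have h7 : (7 : ℝ) ≤ ((4 * N + 3 : ℕ) : ℝ) := by push_cast; linarith
    have hid : ((4 * N + 4 : ℕ) : ℝ) / ((4 * N + 3 : ℕ) : ℝ) - 1 = 1 / ((4 * N + 3 : ℕ) : ℝ) := by
      rw [div_sub_one ha0.ne']
      push_cast
      ring
    rw [hid] at h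
    have : 1 / ((4 * N + 3 : ℕ) : ℝ) ≤ 1 / 7 := one_div_le_one_div_of_le (by norm_num) h7
    linarith
  obtain ⟨δ₁, hδ₁⟩ : ∃ δ₁ : ℝ, δ₁ = (κ / 2) ^ (N + 1) / (2 * ((N + 1).factorial : ℝ)) := ⟨_, rfl⟩
  have hδ₁0 : 0 < δ₁ := by rw [hδ₁]; positivity
  have hδ₁1 : δ₁ ≤ 1 := by
    rw [hδ₁, div_le_one (by positivity)]
    have h1 : (κ / 2) ^ (N + 1) ≤ 1 := pow_le_one₀ (by positivity) (by linarith)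
    have h2 : (1 : ℝ) ≤ ((N + 1).factorial : ℝ) := by exact_mod_cast (N + 1).factorial_pos
    linarith
  obtain ⟨c, hc⟩ : ∃ c : ℝ, c = δ₁ / 100 := ⟨_, rfl⟩
  have hc0 : 0 < c := by rw [hc]; positivity
  have hc1 : c ≤ 1 / 100 := by rw [hc]; linarith
  refine ⟨c, hc0, fun 𝒜 h𝒜 => ?_⟩
  /- the threshold in `t` -/
  obtain ⟨t₁, ht₁⟩ := sum_inv_primes_window (a := 4 * N + 3) (b := 4 * N + 4) (by omega) (by omega)
    (ε := κ / 4) (by positivity)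
  obtain ⟨t₀, ht₀⟩ := eventually_atTop.mp
    (eventually_large_t t₁ (4 * ((N : ℝ) + 1) / κ) (1 / c) ((2 : ℝ) ^ N / (7 / 10 * δ₁)))
  /- the threshold in `x` -/
  have hγ : 0 < (N : ℝ) + 1 / 4 - u := by linarith
  obtain ⟨x₁, hx₁⟩ := eventually_atTop.mp
    (eventually_large_x N (u := u) (γ := (N : ℝ) + 1 / 4 - u) hγ (by ring)
      (2 * ((t₀ : ℝ) + 1) ^ (4 * N + 4))
      (((2 : ℝ) ^ (4 * N + 5)) ^ ((N : ℝ) + 1 / 4)) (C₇ := 8 * (1 / c + 1)) (by positivity) c)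
  refine ⟨max x₁ (Real.exp 2), fun x hx => ?_⟩
  obtain ⟨hX2, hX3, hX4, hX6, hX7⟩ := hx₁ x (le_of_max_le_left hx)
  have hxe : Real.exp 2 ≤ x := le_of_max_le_right hx
  have hx0 : 0 < x := (Real.exp_pos 2).trans_le hxe
  have hlogx : 2 ≤ Real.log x := by rw [Real.le_log_iff_exp_le hx0]; exact hxe
  have hlog0 : 0 < Real.log x := by linarith
  have hlog1 : 1 ≤ Real.log x := by linarith
  /- `t` -/
  obtain ⟨t, ht⟩ : ∃ t : ℕ, t = ⌊(Real.log x / 2) ^ (((4 * N + 4 : ℕ) : ℝ)⁻¹)⌋₊ := ⟨_, rfl⟩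
  obtain ⟨ht1, htb_le, htb_gt, htE_le, hlogE⟩ := t_pow_facts N hlogx ht
  have ht₀t : t₀ ≤ t := by
    have h1 : ((t₀ : ℝ) + 1) ^ (4 * N + 4) ≤ Real.log x / 2 := by linarith only [hX2]
    have h2 : ((t₀ : ℝ) + 1) ^ (4 * N + 4) < ((t : ℝ) + 1) ^ (4 * N + 4) := h1.trans_lt htb_gt
    have h3 : (t₀ : ℝ) + 1 < (t : ℝ) + 1 := lt_of_pow_lt_pow_left₀ _ (by positivity) h2
    have h5 : t₀ < t + 1 := by exact_mod_cast (by linarith only [h3] : (t₀ : ℝ) < (t : ℝ) + 1)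
    omega
  obtain ⟨ht1', ht2', ht3', ht4', ht5'⟩ := ht₀ t ht₀t
  obtain ⟨hs1, hs2, hta, htbig⟩ :=
    t_threshold_facts (N := N) hκ0 hδ₁0 ht2' (by have h := ht₁ t ht1'; rwa [← hκ] at h) ht3' ht5'
  -- `(log x)^u ≤ 4 t^E`
  have hlogu : Real.log x ^ u ≤ 4 * (t : ℝ) ^ ((4 * N + 4) * N + N + 1) := by
    have hC₆ : (0 : ℝ) < ((2 : ℝ) ^ (4 * N + 5)) ^ ((N : ℝ) + 1 / 4) := by positivity
    refine le_of_mul_le_mul_right ?_ hC₆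
    calc Real.log x ^ u * ((2 : ℝ) ^ (4 * N + 5)) ^ ((N : ℝ) + 1 / 4)
        ≤ 4 * Real.log x ^ ((N : ℝ) + 1 / 4) := hX6
      _ ≤ 4 * (((2 : ℝ) ^ (4 * N + 5)) ^ ((N : ℝ) + 1 / 4) * (t : ℝ) ^ ((4 * N + 4) * N + N + 1)) :=
          by linarith only [hlogE]
      _ = 4 * (t : ℝ) ^ ((4 * N + 4) * N + N + 1) * ((2 : ℝ) ^ (4 * N + 5)) ^ ((N : ℝ) + 1 / 4) :=
          by ring
  /- the sieving modulus `q` -/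
  obtain ⟨hq1, hqL, hqcx⟩ := q_facts N t hx0 hlog0 htb_le hX3 hX4 hc0 (u := u)
  /- the row modulus `ℓ` (Bertrand) -/
  have htE_le' : (t : ℝ) ^ ((4 * N + 4) * N + N + 1) ≤ Real.log x ^ (N + 2) :=
    htE_le.trans (pow_le_pow_right₀ hlog1 (by omega))
  have htb_le' : (t : ℝ) ^ (4 * N + 4) ≤ Real.log x := by linarith only [htb_le, hlog0]
  obtain ⟨ℓ, hℓp, hℓB, hℓlo, hℓhi, hJ1, hJ2⟩ :=
    exists_bertrand_prime (pow_pos (by omega) _) (Nat.one_le_pow _ _ (by omega))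
      (bertrand_input hc0 hlog0 ht1 htE_le htb_le' hX7)
  push_cast at hℓlo hℓhi
  obtain ⟨hℓL, hℓc, hℓx⟩ := ell_facts hx0 hlog0 hc0 ht1 ht4' htE_le' hX7 hlogu hℓlo hℓhi
  have hcop := coprime_prod_primes_window hℓp hℓB (N := N)
  /- negate the conclusion at `x` and conclude -/
  by_contra hcon
  simp only [not_exists, not_and, not_le] at hcon
  have hregℓ := hcon ℓ hℓp.one_le hℓL
  have hregq := hcon (∏ p ∈ Pr(t, N), p) hq1 hqL
  have hmat := maierMatrix_bounds h𝒜 hℓp hq1 hcop hc0 hc1 hℓc hℓx hqcx hregℓ hregq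
  exact sieve_side_contradiction ht2' hκ0 hκ1 hδ₁ hc hs1 hs2 hta hJ1 hJ2 htbig hmat

end Literature.Barriers.Parity

end
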